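import Literature.AnabelianGeometry.EtaleTheta.Discharge.Sec2Cor219iiiOfConstConjugator
import Literature.AnabelianGeometry.EtaleTheta.Discharge.Sec2Cor219iiiHeartAtModelChi
import Literature.AnabelianGeometry.EtaleTheta.Discharge.Sec1Thm110ModelTateNV
import Literature.AnabelianGeometry.EtaleTheta.Discharge.Sec2RigidityAtModelTate
import HarnessLib

/-!
# [EtTh] Cor. 2.19 (iii) (`ThetaEnvTower.Cor219_iii`) at the Tate model on the CONSTANT route, modulo ONE displayed clause
# (row «COR219III-M1b»; proof-only instantiation of `cor219_iii_of_const_conjugator_of_origin`)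

S. Mochizuki, *The Étale Theta Function and its Frobenioid-theoretic Manifestations* [EtTh], Publ. RIMS **45** (2009), §2
Cor. 2.19 (iii) p. 64 [cite: MochizukiEtTh2009, Cor 2.19 (iii) p.64].  Cell `abc-iut`, row «COR219III-M1b» (abc-iut-L6-lead gen 7,
ruling 2026-08-27T02:48:56Z: CONSTANT route `x M := w`, no M2), seat abc-iut-L1-t6 (gen 5), FILE 2.  PROOF-ONLY.

At the stage-2 model `modelχq p i j` (`j` even) with the record `X̲̲`-choice (`C.Huu = Huuχq p i j l`, `l` odd) every input of
abc-iut-C-hgal-2's tower assembly `cor219_iii_of_hearts_of_origin` (p482618) EXCEPT the per-`(γ, γ̃)` clause is a theorem of the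
tree: origin guard `ThetaSetting.modelχq_isEtThOrigin`, open augmentation `isOpenMap_aug_modelχq` ↦ `isOpenMap_aug_PiYdd`,
(D1*) density at the record point `b₀ = inl(b̂^{ι(1)²})` = abc-iut-L1-t6's `dense_closure_heart_record` (p488563), hearts at EVERY
level from ONE value and level compatibility (b2) := `rfl` = `cor219_iii_of_const_conjugator_of_origin` (p490284).  What is
DISPLAYED, in C-hgal-2's own binder shape, is the clause **(H)**: for every admissible `(γ, hγ, γ̄, hcompat)`, `γ` stabilises
`Ker θ|_{Π^tp_X̲̲}` and `θ⁻¹(l·Δ_Θ)` (Cor. 2.18 (i)-type stability) and, for every induced `γ̃`, SOME root cocycle `f₀` and SOME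
`w ∈ Π^tp_X̲̲` satisfy `red_M (γ̃⁻¹ f₀(γ b̃₀)) = red_M (conjRoot w f₀ b̃₀)` at every level `M ∈ E` — the VALUE of the transported
root cocycle at the one point `b₀` for a level-constant conjugator (row «COR219III-M1b-EVEN (β)», clause (β1), abc-iut-w5-d187;
or the explicit-`m_M` route M2).  §1 `cor219_iii_modelχq_of_const_conjugator` (every `i`, even `j`, every étale-theta datum `E`,
binders `hC hS h15`); §2 `cor219_iii_modelTate_inr_of_const_conjugator` at the datum OF RECORD `etaleThetaDataχqInr p` over
`modelχq p 1 2` with `Compat` / `Sec2Hyps` / Prop. 1.5 (iii) discharged BY NAME (`compat_modelχq`, `ThetaSetting.modelχq_sec2Hyps`,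
`prop15iii_etaleThetaDataχqInr`) — binders = data `l, C, hHuu, τ` and (H) ONLY.

HONEST LABEL: statements about the SEMI-SYNTHETIC stage-2 model of OUR typed §1 interface (binder-discharge evidence), NOT about
the tempered fundamental group of a curve; (H) is displayed, not asserted; nothing of [EtTh] (refereed) is asserted for a curve;
no side is taken on [IUTchIII] Cor. 3.12; typed ≠ proved; instantiated ≠ endorsed.
-/

noncomputable section

namespace Literature.AnabelianGeometry.EtaleTheta.SettingModel

open Literature.AnabelianGeometry.SemiGraphs _root_.Function _root_.Topology

variable (p : ℕ) [Fact p.Prime] (i j : ℤ) (hj : Even j)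

/-! ## §1. At `modelχq p i j` with the record `X̲̲`-choice, every étale-theta datum -/

set_option synthInstance.maxHeartbeats 200000 in
set_option maxHeartbeats 1000000 in
/-- **`ThetaEnvTower.Cor219_iii` at `modelχq p i j` (record `X̲̲`-choice, `l` odd) modulo the displayed clause (H)** — one
application of `cor219_iii_of_const_conjugator_of_origin` with the origin guard, the open augmentation and the (D1*) density at
`b₀ = inl(b̂^{ι(1)²})` discharged BY NAME.  The two `set_option`s only raise elaboration limits for the nested subtype carriers
over the `abbrev` record. [cite: MochizukiEtTh2009, Cor 2.19 (iii) p.65] -/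
theorem cor219_iii_modelχq_of_const_conjugator {E : (ThetaSetting.modelχq p i j hj).EtaleThetaData} {l : ℕ+}
    (hl : Odd (l : ℕ)) (C : E.DoubleUnderline l) (hHuu : C.Huu = Huuχq p i j l hl) {Es : Set ℕ+}
    (τ : (ThetaSetting.modelχq p i j hj).CyclotomeTower l Es)
    (hC : (ThetaSetting.modelχq p i j hj).Compat) (hS : (ThetaSetting.modelχq p i j hj).Sec2Hyps)
    (h15 : ThetaSetting.Prop15iii E hC)
    (H : ∀ (γ : (C.thetaEnvTower τ hC hS).PiX ≃ₜ* (C.thetaEnvTower τ hC hS).PiX)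
      (hγ : (C.thetaEnvTower τ hC hS).PiYdd.map γ.toMulEquiv.toMonoidHom = (C.thetaEnvTower τ hC hS).PiYdd)
      (γμ : ∀ M : Es, (C.thetaEnvTower τ hC hS).mu M ≃* (C.thetaEnvTower τ hC hS).mu M)
      (_ : ∀ (M : Es) (g : (C.thetaEnvTower τ hC hS).lDeltaTheta) (hg : γ g ∈ (C.thetaEnvTower τ hC hS).lDeltaTheta),
        (C.thetaEnvTower τ hC hS).thetaMod M ⟨γ g, hg⟩ = γμ M ((C.thetaEnvTower τ hC hS).thetaMod M g)),
      ((ThetaSetting.modelχq p i j hj).toTheta.comp C.Huu.subtype).ker.map γ.toMulEquiv.toMonoidHom =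
          ((ThetaSetting.modelχq p i j hj).toTheta.comp C.Huu.subtype).ker ∧
      (C.thetaEnvTower τ hC hS).lDeltaTheta.map γ.toMulEquiv.toMonoidHom = (C.thetaEnvTower τ hC hS).lDeltaTheta ∧
      ∀ (γΛ : (ThetaSetting.modelχq p i j hj).lDeltaTheta l ≃* (ThetaSetting.modelχq p i j hj).lDeltaTheta l)
        (_ : ∀ (g : (C.thetaEnvTower τ hC hS).lDeltaTheta) (hg : γ g ∈ (C.thetaEnvTower τ hC hS).lDeltaTheta),
          C.toLDelta ⟨γ g, hg⟩ = γΛ (C.toLDelta g)),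
        ∃ (f₀ : contCocycles (ThetaSetting.modelχq p i j hj).toTheta (ThetaSetting.modelχq p i j hj).DeltaTheta C.GtpYdduu)
          (hf₀ : f₀ ∈ C.rootCocycles hC) (w : C.Huu),
          ∀ M : Es,
            (τ.mod M).red (γΛ.symm ⟨(f₀.1 (C.inclYdduu ⟨γ
                (⟨⟨(SemidirectProduct.inl (bPowGfp ((iotaZ (Multiplicative.ofAdd 1)) ^ 2)) : PiTpχq p i j),
                    hHuu.ge (inl_bPowGfp_mem_Huuχq p i j l hl _)⟩,
                  inl_bPowGfp_sq_mem_GtpYdd_modelχq p i j hj _⟩ : (C.thetaEnvTower τ hC hS).PiYdd),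
                C.apply_mem_PiYdd τ hC hS γ hγ _⟩) : (ThetaSetting.modelχq p i j hj).GtpTheta), hf₀.1 _⟩) =
              (τ.mod M).red ⟨(C.conjRoot hC w f₀.1 (C.inclYdduu
                ⟨⟨(SemidirectProduct.inl (bPowGfp ((iotaZ (Multiplicative.ofAdd 1)) ^ 2)) : PiTpχq p i j),
                    hHuu.ge (inl_bPowGfp_mem_Huuχq p i j l hl _)⟩,
                  inl_bPowGfp_sq_mem_GtpYdd_modelχq p i j hj _⟩) : (ThetaSetting.modelχq p i j hj).GtpTheta),
                ((ThetaSetting.modelχq p i j hj).lDeltaTheta_normal l).conj_mem _ (hf₀.1 _) _⟩) :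
    (C.thetaEnvTower τ hC hS).Cor219_iii :=
  C.cor219_iii_of_const_conjugator_of_origin τ (ThetaSetting.modelχq_isEtThOrigin p i j hj) hC hS h15
    (C.isOpenMap_aug_PiYdd τ hC hS (isOpenMap_aug_modelχq p i j hj))
    ⟨⟨(SemidirectProduct.inl (bPowGfp ((iotaZ (Multiplicative.ofAdd 1)) ^ 2)) : PiTpχq p i j),
        hHuu.ge (inl_bPowGfp_mem_Huuχq p i j l hl _)⟩,
      inl_bPowGfp_sq_mem_GtpYdd_modelχq p i j hj _⟩
    (dense_closure_heart_record p i j hj hl C hHuu τ hC hS) H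

/-! ## §2. At the datum OF RECORD `etaleThetaDataχqInr p` over `modelχq p 1 2`: binders = data and (H) only -/

set_option synthInstance.maxHeartbeats 200000 in
set_option maxHeartbeats 1000000 in
/-- **`ThetaEnvTower.Cor219_iii` for the tower of the étale-theta datum OF RECORD at the Tate instance** (`modelχq p 1 2`,
`η̈^Θ := etaDdχq` along `inr`; record `X̲̲`-choice, `l` odd), with `Compat`, `Sec2Hyps` and Prop. 1.5 (iii) discharged BY NAME
(`compat_modelχq`, `ThetaSetting.modelχq_sec2Hyps`, `prop15iii_etaleThetaDataχqInr`) — modulo the displayed clause (H) ONLY.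
[cite: MochizukiEtTh2009, Cor 2.19 (iii) p.65] -/
theorem cor219_iii_modelTate_inr_of_const_conjugator {l : ℕ+} (hl : Odd (l : ℕ))
    (C : (etaleThetaDataχqInr p).DoubleUnderline l) (hHuu : C.Huu = Huuχq p 1 2 l hl) {Es : Set ℕ+}
    (τ : (ThetaSetting.modelχq p 1 2 even_two).CyclotomeTower l Es)
    (H : ∀ (γ : (C.thetaEnvTower τ (compat_modelχq p 1 2 even_two) (ThetaSetting.modelχq_sec2Hyps p 1 2 even_two)).PiX ≃ₜ*
        (C.thetaEnvTower τ (compat_modelχq p 1 2 even_two) (ThetaSetting.modelχq_sec2Hyps p 1 2 even_two)).PiX)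
      (hγ : (C.thetaEnvTower τ (compat_modelχq p 1 2 even_two) (ThetaSetting.modelχq_sec2Hyps p 1 2 even_two)).PiYdd.map
          γ.toMulEquiv.toMonoidHom =
        (C.thetaEnvTower τ (compat_modelχq p 1 2 even_two) (ThetaSetting.modelχq_sec2Hyps p 1 2 even_two)).PiYdd)
      (γμ : ∀ M : Es, (C.thetaEnvTower τ (compat_modelχq p 1 2 even_two) (ThetaSetting.modelχq_sec2Hyps p 1 2 even_two)).mu M ≃*
        (C.thetaEnvTower τ (compat_modelχq p 1 2 even_two) (ThetaSetting.modelχq_sec2Hyps p 1 2 even_two)).mu M)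
      (_ : ∀ (M : Es) (g : (C.thetaEnvTower τ (compat_modelχq p 1 2 even_two) (ThetaSetting.modelχq_sec2Hyps p 1 2 even_two)).lDeltaTheta)
        (hg : γ g ∈ (C.thetaEnvTower τ (compat_modelχq p 1 2 even_two) (ThetaSetting.modelχq_sec2Hyps p 1 2 even_two)).lDeltaTheta),
        (C.thetaEnvTower τ (compat_modelχq p 1 2 even_two) (ThetaSetting.modelχq_sec2Hyps p 1 2 even_two)).thetaMod M ⟨γ g, hg⟩ =
          γμ M ((C.thetaEnvTower τ (compat_modelχq p 1 2 even_two) (ThetaSetting.modelχq_sec2Hyps p 1 2 even_two)).thetaMod M g)),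
      ((ThetaSetting.modelχq p 1 2 even_two).toTheta.comp C.Huu.subtype).ker.map γ.toMulEquiv.toMonoidHom =
          ((ThetaSetting.modelχq p 1 2 even_two).toTheta.comp C.Huu.subtype).ker ∧
      (C.thetaEnvTower τ (compat_modelχq p 1 2 even_two) (ThetaSetting.modelχq_sec2Hyps p 1 2 even_two)).lDeltaTheta.map
          γ.toMulEquiv.toMonoidHom =
        (C.thetaEnvTower τ (compat_modelχq p 1 2 even_two) (ThetaSetting.modelχq_sec2Hyps p 1 2 even_two)).lDeltaTheta ∧
      ∀ (γΛ : (ThetaSetting.modelχq p 1 2 even_two).lDeltaTheta l ≃* (ThetaSetting.modelχq p 1 2 even_two).lDeltaTheta l)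
        (_ : ∀ (g : (C.thetaEnvTower τ (compat_modelχq p 1 2 even_two) (ThetaSetting.modelχq_sec2Hyps p 1 2 even_two)).lDeltaTheta)
          (hg : γ g ∈ (C.thetaEnvTower τ (compat_modelχq p 1 2 even_two) (ThetaSetting.modelχq_sec2Hyps p 1 2 even_two)).lDeltaTheta),
          C.toLDelta ⟨γ g, hg⟩ = γΛ (C.toLDelta g)),
        ∃ (f₀ : contCocycles (ThetaSetting.modelχq p 1 2 even_two).toTheta (ThetaSetting.modelχq p 1 2 even_two).DeltaTheta
            C.GtpYdduu)
          (hf₀ : f₀ ∈ C.rootCocycles (compat_modelχq p 1 2 even_two)) (w : C.Huu),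
          ∀ M : Es,
            (τ.mod M).red (γΛ.symm ⟨(f₀.1 (C.inclYdduu ⟨γ
                (⟨⟨(SemidirectProduct.inl (bPowGfp ((iotaZ (Multiplicative.ofAdd 1)) ^ 2)) : PiTpχq p 1 2),
                    hHuu.ge (inl_bPowGfp_mem_Huuχq p 1 2 l hl _)⟩,
                  inl_bPowGfp_sq_mem_GtpYdd_modelχq p 1 2 even_two _⟩ :
                  (C.thetaEnvTower τ (compat_modelχq p 1 2 even_two) (ThetaSetting.modelχq_sec2Hyps p 1 2 even_two)).PiYdd),
                C.apply_mem_PiYdd τ _ _ γ hγ _⟩) : (ThetaSetting.modelχq p 1 2 even_two).GtpTheta), hf₀.1 _⟩) =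
              (τ.mod M).red ⟨(C.conjRoot (compat_modelχq p 1 2 even_two) w f₀.1 (C.inclYdduu
                ⟨⟨(SemidirectProduct.inl (bPowGfp ((iotaZ (Multiplicative.ofAdd 1)) ^ 2)) : PiTpχq p 1 2),
                    hHuu.ge (inl_bPowGfp_mem_Huuχq p 1 2 l hl _)⟩,
                  inl_bPowGfp_sq_mem_GtpYdd_modelχq p 1 2 even_two _⟩) : (ThetaSetting.modelχq p 1 2 even_two).GtpTheta),
                ((ThetaSetting.modelχq p 1 2 even_two).lDeltaTheta_normal l).conj_mem _ (hf₀.1 _) _⟩) :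
    (C.thetaEnvTower τ (compat_modelχq p 1 2 even_two) (ThetaSetting.modelχq_sec2Hyps p 1 2 even_two)).Cor219_iii :=
  cor219_iii_modelχq_of_const_conjugator p 1 2 even_two hl C hHuu τ (compat_modelχq p 1 2 even_two)
    (ThetaSetting.modelχq_sec2Hyps p 1 2 even_two) (prop15iii_etaleThetaDataχqInr p _) H

end Literature.AnabelianGeometry.EtaleTheta.SettingModel

end
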